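import Mathlib
import Summits.ValiantsHypothesis.ValiantsHypothesis.Theses.ContractivityPrice
import Summits.ValiantsHypothesis.ValiantsHypothesis.Theorems.ContractivityPriceStabilisedPerZeroFree
import Summits.ValiantsHypothesis.ValiantsHypothesis.Theorems.ContractivityPriceQpComposition
import Literature.Analysis.OperatorTheory.ContractiveDeterminantalRepresentation
import Literature.Analysis.OperatorTheory.ContractiveDetComplexity
import Summits.ValiantsHypothesis.ValiantsHypothesis.Theorems.ContractivityPriceContractiveHardnessNonSurjective
import Summits.ValiantsHypothesis.ValiantsHypothesis.Theorems.ContractivityPriceContractiveHardnessSurjectiveReduction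
import Summits.ValiantsHypothesis.ValiantsHypothesis.Theorems.ContractivityPriceContractiveHardnessDvdForcesSurjective
import Summits.ValiantsHypothesis.ValiantsHypothesis.Theorems.ContractivityPriceContractiveHardnessRealizationRename

/-!
# Birth skeleton (BC3) for crux `ContractivityPrice.ContractiveHardness`
# (stmt-ValiantsHypothesis-10584, route-ValiantsHypothesis-ContractivityPrice; skeleton-register, gen 1)

Crux decl `Summit.ValiantsHypothesis.ValiantsHypothesis.Theses.ContractivityPrice.ContractiveHardness`
(K2 of the route): for every `c` there is `n` such that the stabilised permanent
`Q_n = per_n(I + z/(4n))` has NO contractive realization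
`Q_n = a · det(I_R + diag(z ∘ κ) · K)`, `‖K‖_op ≤ 1`, of size `R ≤ 2^((log₂ n + c)^c)`.

## The line: PRICE OF UNITARITY + REALIZATION HARDNESS (the route's K1/K2 split, one level up)

By GKVW 2012 (arXiv:1208.2288) every contractive realization `p = det(I − K Z_n)` makes the rational
inner function `f_n = z^n p̄(1/z)/p` (`n = blockOrder κ`, `|n| = R`) Schur–Agler (Thm 5.2, "eventual Agler
denominator of order `n`"), hence — Knese, Publ. Mat. 55 (2011) [gK10] / Illinois J. Math. (arXiv:1008.4560)
Thm 2.1 + the lurking isometry — `f_n` has a FINITE unitary transfer-function realization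
`f_n = A + B Z_ρ (I − D Z_ρ)⁻¹ C`, `U = [[A,B],[C,D]]` unitary, of SOME order `ρ` (Knese's dimension count:
`ρ_j ≤ n_j ∏_{i≠j} (n_i+1)`, exponential in the number of variables).  Conversely, from a unitary realization of
`f_n` of order `ρ` the argument of GKVW Thm 5.6 (PROVED in tree: `GKVW2012_thm_5_6_holds`) produces
`p · q = det(I − D Z_ρ)` with `D` a contraction — a contractive realization of `p` TIMES A STABLE MULTIPLIER
(the form of GKVVW 2016, arXiv:1501.05527 Thm 4.1), of size `|ρ|`; and GKVW Rem. 5.10 shows the two orders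
genuinely differ (`p = 1 − (z₁+z₂+z₃)/3`: contractive order `(1,1,1)`, minimal realization order `(2,2,2)`).
So the size of a UNITARY REALIZATION of `f_n` is a second normed complexity measure sandwiching `cdc`
up to a multiplier, and K2 splits exactly as the route split VP ≠ VNP into K1/K2:

* `stub_priceOfUnitarity` (OPEN, quantitative; existence known): a contractive realization of size `R` of a
  polynomial `p` in `≤ N` variables with no zero on the closed polydisc of radius `2` yields a unitary
  realization of `f_{blockOrder κ} = z^n p̄(1/z)/p` of order `R' ≤ 2^((log₂(R+N)+d)^d)`, `d` absolute —
  "Knese's ranks are quasi-polynomial for DETERMINANTAL Schur–Agler denominators with margin".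
  Stated with the tree's vocabulary `HasContractiveDetReprWith`, `conjReverse`, `blockOrder`, `IsRealizedBy`
  (Literature/Analysis/OperatorTheory/ContractiveDeterminantalRepresentation.lean).
* `stub_realizationHardness` (OPEN, the hardness half): for every `c, c'` there is `n` such that for every
  reflection order `blockOrder κ`, `κ : Fin R → [n]²`, `R ≤ 2^((log₂ n + c)^c)`, the rational function
  `z^{blockOrder κ} Q̄_n(1/z)/Q_n` has NO unitary realization of order `R' ≤ 2^((log₂ n + c')^c')`.
  By the Thm-5.6 argument its failure gives quasi-polynomial MULTIPLIER-contractive realizations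
  `Q_n · q = det(I − D Z_ρ)`, hence (factor closure of quasi-polynomial ABP size) `dc(per_n)` quasi-polynomial:
  like the crux itself it is implied, morally, by `DetQP.DetqpThesis`; unlike the crux it lives in the model
  where the Agler-decomposition RANKS (= realization order, lurking isometry) are the measured quantity — the
  Hermitian-SOS-rank / nuclear-norm-dual engines named by the route act on exactly this object.

Neither stub is comparable to the crux by a cheap implication: `stub_realizationHardness → ContractiveHardness`
needs the price stub (Knese's bound is exponential), `ContractiveHardness → stub_realizationHardness` would need
multiplier removal (the factor problem for contractive realizations); `stub_priceOfUnitarity` is a statement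
about all stable pencils.  BC3 probes (`stub → ContractiveHardness`, `stub → ValiantsHypothesis` by
`first | exact? | simpa | aesop`) fail for both — see the registrar's NOTES.md.

COMPOSITION (original; see RESHAPE 1 below for the current three-stub form)
`ContractiveHardness_of : Stmt.stub_priceOfUnitarity → Stmt.stub_realizationHardness →
ContractiveHardness` (kernel-checked, no sorry): given `c`, take `d` from the price stub, `c'` from the PROVED
route support `qpComposition_proof c d`, and `n` from the hardness stub at `(c, c')`; a contractive realization
`Q_n = C a · det(1 + diag(X ∘ κ) K)` of size `R ≤ 2^((log₂ n + c)^c)` is, by `Q_n(0) = 1`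
(`eval_zero_stabPer`) and the tree's bridge `hasContractiveDetRepr_iff_exists_C_mul`, a
`HasContractiveDetReprWith Q_n κ₀`; the PROVED support `stabilisedPerZeroFree_proof` gives the radius-2 margin,
so the price stub (with `N = n²`) returns a unitary realization of order
`R' ≤ 2^((log₂(R + n²) + d)^d) ≤ 2^((log₂ n + c')^c')`, which the hardness stub forbids.

## Shape (skeleton audit by-name rule, as in `Cruxes/DetqpSuperquadratic/Lines/vertex_power_width.lean`)
* `Stmt.stub_…` — the two stub statements as precise `Prop`s, named like the stubs;
* `stub_…` — the same statements as sorried theorems (the REGISTERED stubs; `sorry` occurs nowhere else);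
* `ContractiveHardness_of` — the composition, real proof; `ContractiveHardness_proof : ContractiveHardness :=
  ContractiveHardness_of stub_priceOfUnitarity stub_realizationHardness` ties the two copies.
Both stubs are DEF-FREE beyond Mathlib + `Literature.Analysis.OperatorTheory` (`HasContractiveDetReprWith`,
`IsRealizedBy`, `conjReverse`, `blockOrder`) + `Literature…perPoly`, so each can land as
`Theorems/ContractivityPriceContractiveHardness<Stub>.lean` with `--supports stmt-ValiantsHypothesis-10584`.

**Disproof used.** None exists: `Cruxes/ContractiveHardness/` had no workfiles (no `Disproof.lean`, no
`Negative/` lemma) at registration (2026-08-17); `ledger negatives --problem ValiantsHypothesis` has no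
statement about contractive or unitary realizations.  Hardest stub: `stub_realizationHardness`.

## RESHAPE 1 (lead c1, 2026-08-17): the hardness stub split by surjectivity of the block structure

`stub_realizationHardness` is replaced by TWO registered stubs with the same composition idea:
* `stub_realizationHardness_nonSurjective` — PROVED (Theorems file
  `ContractivityPriceContractiveHardnessNonSurjective.lean`, using the new Literature lemma
  `IsRealizedBy.norm_eval_le` of `Literature/Analysis/OperatorTheory/TransferFunctionSchurBound.lean`):
  if `κ : Fin R → [n]²` misses a variable `e` (every `κ` with `R < n²`), then `blockOrder κ e = 0`, the
  truncated reflection `conjReverse (blockOrder κ) Q_n` is not the true reflection, and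
  `conjReverse m Q_n / Q_n` violates the Schur bound `|num| ≤ |den|` at `z⋆ = 𝟙[e ↦ 0]`
  (`|num(z⋆)| = Q_n(𝟙) > Q_n(𝟙[e ↦ 0]) = |den(z⋆)|`, nonnegative coefficients + `e` occurs in `Q_n`):
  NO unitary realization of ANY order exists — no size hypothesis needed;
* `stub_realizationHardness_surjective` — the OPEN core: the same claim for SURJECTIVE `κ`
  (`blockOrder κ ≥ 𝟙`, `R ≥ n²`), where `z^m Q̄_n(1/z)/Q_n` IS a Schur function (inner, continuous on
  the closed polydisc), and by the argument of GKVW Thm 5.6 (`Q_n` irreducible, coprime to its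
  reflection) a unitary realization of order `κ'` gives `Q_n · q = det(I − D Z_{κ'})` with `D` the
  state corner of `U` — a contraction of DEFECT ≤ 1 (`I − D^*D = B^*B`); so this stub is implied by
  "no quasi-polynomial contractive (defect-one) determinantal pencil has `Q_n` as a factor", a
  multiples-version of the crux itself (hence ⇐ extended VH + factor closure), and implies nothing
  cheaper.  STUCK here = the genuine lower bound.
`ContractiveHardness_of` now takes the three stubs and splits on `Function.Surjective κ₀`.

## RESHAPE 2 (lead c1, 2026-08-17): the surjective case reduced to defect-one contractive multiples

`stub_realizationHardness_surjective` is replaced by TWO registered stubs: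
* `stub_surjectiveReduction` — PROVED and landed (p148766, Theorems file
  `ContractivityPriceContractiveHardnessSurjectiveReduction.lean`): the argument of GKVW Thm 5.6 run
  for `Q_n` (`n ≥ 2`, `κ` surjective): a colligation `U` realizing `conjReverse (blockOrder κ) Q_n / Q_n`
  with block structure `κ'` has `Q_n ∣ det(I − U₂₂ Z_{κ'})` (`Q_n` irreducible — von zur Gathen + the
  affine automorphism —, coprime to monomials, and `Q_n ∤ z^𝟙 Q̄_n(1/z)` by a degree count);
* `stub_defectOneMultiplesHard` — the OPEN core ("CMH₁"): for every `c'` there is `n ≥ 2` such that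
  `Q_n` divides NO pencil determinant `det(I − D Z_{κ'})` of size `R' ≤ 2^((log₂ n + c')^c')` whose
  matrix `D = U₂₂` is the corner of a unitary `U` on `ℂ ⊕ ℂ^{R'}` (equivalently: a contraction of
  defect `rank(I − D^*D) ≤ 1`).  A priori incomparable with the crux (restricted matrices, but
  multiples allowed); implied, morally, by the extended Valiant hypothesis plus factor closure of
  quasi-polynomial determinantal size; the reflection order `m` and the parameter `c` no longer occur.
`ContractiveHardness_of` takes the four stubs {price, nonSurjective ✓, surjectiveReduction ✓,
defectOneMultiplesHard}: `n` comes from CMH₁, and in the surjective case the reduction feeds CMH₁.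

## RESHAPE 3 (lead c2, 2026-08-17): variable counting split off; the core keeps every hypothesis

`stub_defectOneMultiplesHard` (CMH₁) is replaced by TWO registered stubs, and CMH₁ itself is kept
as the `Prop` `Stmt.stub_defectOneMultiplesHard` with the sorry-free comparison
`stub_unitaryRealizationHardCore_of_CMH₁` (the reshape is monotone: the old stub implies the new):
* `stub_dvdForcesSurjective` — PROVABLE NOW (variable counting): for `n ≥ 1`, if `Q_n` divides a
  pencil determinant `det(I − D Z_{κ'})` (any square `D`) then `κ'` is surjective — the pencil
  determinant only involves the variables read by `κ'`, a divisor of a non-zero polynomial only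
  involves its variables, and every `z_e` occurs in `Q_n`.  Hence `R' ≥ n²`, which is exactly the
  content of CMH₁ for `c' ≤ 1`;
* `stub_unitaryRealizationHardCore` — the OPEN core in its WEAKEST form: the statement receives
  every datum the composition holds — the contractive realization itself
  (`HasContractiveDetReprWith Q_n κ`, `κ` surjective, `R ≤ 2^((log₂ n + c)^c)`), the unitary
  realization of `z^{blockOrder κ} Q̄_n(1/z) / Q_n` delivered by the price stub (`U` unitary, block
  structure `κ'` surjective, `R' ≤ 2^((log₂ n + c')^c')`) and the divisibility
  `Q_n ∣ det(I − U₂₂ Z_{κ'})` — and must derive `False`.  It is implied by CMH₁ (drop hypotheses), by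
  the crux restricted to surjective block structures (drop the unitary data), and — like the crux —
  morally by the extended Valiant hypothesis; what it adds over the bare crux is exactly the
  Agler-decomposition / defect-one structure (`I − U₂₂^*U₂₂ = U₁₂^*U₁₂`, `toBlocks₂₂_defect_eq`) in
  which the norm is visible as Hermitian sums of squares of quasi-polynomial rank.
`ContractiveHardness_of` takes {price, nonSurjective ✓, surjectiveReduction ✓, dvdForcesSurjective,
unitaryRealizationHardCore}: `n` from the core at `(c, c')`; surjective `κ₀` ⇒ reduction ⇒
divisibility ⇒ `κ'` surjective ⇒ core; non-surjective `κ₀` ⇒ the Schur obstruction.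

## RESHAPE 4 (lead c2, 2026-08-17): the price stub reduced to distinct variables, margin-free

`stub_priceOfUnitarity` is replaced by TWO registered stubs whose composition
(`priceOfUnitarity_of`, sorry-free) is the old statement:
* `stub_realizationRename` — PROVABLE NOW (functoriality): a realization of
  `z^𝟙 p̄₀(1/z) / p₀` for the TAUTOLOGICAL block structure (`p₀ = gkvwDet id K`, one fresh variable per
  row of `K`) with block structure `κ' : Fin R' → Fin R` pushes forward along any colouring
  `κ : Fin R → σ` to a realization of `z^{blockOrder κ} p̄(1/z) / p`, `p = gkvwDet κ K = rename κ p₀`,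
  with block structure `κ ∘ κ'` and the SAME unitary `U` (`rename κ` is a ring map; it sends
  `blockVar κ'` to `blockVar (κ ∘ κ')`, commutes with `det`/`adjugate`, and
  `rename κ (conjReverse (blockOrder id) p₀) = conjReverse (blockOrder κ) p` by GKVW (5.5),
  `conjReverse_blockOrder_gkvwDet`, on both sides);
* `stub_priceDistinct` — the OPEN core of the price, in its cleanest form: there is `d` such that for
  every `R × R` contraction `K` the rational inner function `det(Z − K^*)/det(I − K Z)`,
  `Z = diag(z₁, …, z_R)` (R DISTINCT variables, no margin hypothesis), has a unitary realization of
  order `R' ≤ 2^((log₂ R + d)^d)`.  Numerics (lead c1 worker, lead c2 worker W2, this lead):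
  the minimal order is `R(R−1)` (uniform profile `R−1`) for generic and for rank-one `K`,
  `R = 2, …, 5` — quadratic, far inside the bound; the natural conjecture is `R' ≤ R(R−1)` always
  (`d = 2`).  The margin hypothesis of the old stub and the variable count `N` are no longer used.

## STATE AT THE END OF LEAD c2 (2026-08-17)

Closed stubs (landed): `stub_realizationHardness_nonSurjective` p147230, `stub_surjectiveReduction`
p148766 (lead c1); `stub_dvdForcesSurjective` p152734, `stub_realizationRename` p155269 (lead c2); side
results `contractiveHardness_of_detqpThesis` p154430 (`DetQP.DetqpThesis → ContractiveHardness`,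
Theorems/ContractivityPriceContractiveHardnessOfDetqp.lean) and the Literature lemma
`agler_identity_of_mem_unitaryGroup` (Literature/Analysis/OperatorTheory/TransferFunctionAglerIdentity.lean,
p157125: a unitary realization of order `m` IS an Agler decomposition with kernels of rank `m_j`, as a
polynomial identity in `ℂ[z, w̄]` — the first step of any attack on the hardness core).
Open stubs = the two research statements the line consists of:
* `stub_priceDistinct` (P): quasi-polynomial unitary-realization order for `det(Z − K^*)/det(I − KZ)`;
  numerically `R(R−1)` for `R ≤ 5` (generic / rank-one / structured / norm-one `K`), explicit
  construction of order `2^{R−1}` known (ball identity), minimal decompositions not canonical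
  (evidence files `numerics_price/SUMMARY.md`, `numerics_priceDistinct/SUMMARY.md` on the item);
* `stub_unitaryRealizationHardCore` (H): a super-quasi-polynomial lower bound on the Agler rank of the
  stabilised permanent's inner function — a restricted-model permanent lower bound of a new kind
  (`A(2) = 8`; nothing published gives `2^{n^ε}`).
-/

namespace Summit.ValiantsHypothesis.ValiantsHypothesis.Cruxes.ContractiveHardness.Birth

open MvPolynomial Matrix
open Literature.Analysis.OperatorTheory
open Literature.Computability.AlgebraicComplexity
open Summit.ValiantsHypothesis.ValiantsHypothesis.Theses.ContractivityPrice

set_option linter.dupNamespace false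

noncomputable section

/-! ## The stabilised permanent `Q_n = per_n(I + z/(4n))` (spelled exactly as in the route items) -/

/-- `Q_n = per_n(I + z/(4n)) ∈ ℂ[z_e : e ∈ [n]²]`, the route's elementary stabilisation of the permanent
(syntactically the expression inlined in `ContractiveHardness`). -/
def stabPer (n : ℕ) : MvPolynomial (Fin n × Fin n) ℂ :=
  MvPolynomial.aeval (fun e : Fin n × Fin n => MvPolynomial.C (if e.1 = e.2 then (1 : ℂ) else 0) +
    MvPolynomial.C ((4 * (n : ℂ))⁻¹) * MvPolynomial.X e)
    (Literature.Computability.AlgebraicComplexity.perPoly (Fin n) ℂ)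

/-- `Q_n(0) = per(I_n) = 1`. [folklore] -/
theorem eval_zero_stabPer (n : ℕ) : MvPolynomial.eval (0 : Fin n × Fin n → ℂ) (stabPer n) = 1 := by
  have hval : MvPolynomial.eval (0 : Fin n × Fin n → ℂ) (stabPer n) =
      (1 + Matrix.of fun i j : Fin n => (4 * (n : ℂ))⁻¹ * (0 : Fin n × Fin n → ℂ) (i, j)).permanent := by
    simp only [stabPer, Literature.Computability.AlgebraicComplexity.perPoly, Matrix.permanent, map_sum,
      map_prod, Matrix.mvPolynomialX_apply, MvPolynomial.aeval_X, map_add, map_mul,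
      MvPolynomial.eval_C, MvPolynomial.eval_X,
      Matrix.add_apply, Matrix.one_apply, Matrix.of_apply]
  rw [hval]
  have h0 : (Matrix.of fun i j : Fin n => (4 * (n : ℂ))⁻¹ * (0 : Fin n × Fin n → ℂ) (i, j)) = 0 := by
    ext i j; simp
  rw [h0, add_zero, Matrix.permanent_one]

/-! ## The two stub statements -/

/-- STUB 1 — PRICE OF UNITARITY (open; quantitative form of GKVW 2012 Thm 5.2 + Knese's realization of
rational inner Schur–Agler functions).  There is an absolute `d` such that: if `p` (in at most `N` variables,
no zero on the closed polydisc of radius `2`) has a contractive determinantal realization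
`p = det(I_R − K Z_n)` with block structure `κ : Fin R → σ` (`HasContractiveDetReprWith p κ`, `n = blockOrder κ`),
then the rational inner function `z^n p̄(1/z)/p` has a UNITARY transfer-function realization
`A + B Z_ρ (I − D Z_ρ)⁻¹ C` (`IsRealizedBy κ' U (conjReverse n p) p`, `U` unitary) of order
`|ρ| = R' ≤ 2^((log₂(R + N) + d)^d)`.  Why plausibly true: existence with `R' ≤ Σ_j n_j ∏_{i≠j}(n_i + 1)` is
Thm 5.2 + [gK10]/Knese2011 Thm 2.1 + lurking isometry; one and two variables cost nothing (Kummert); the only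
recorded gap (GKVW Rem 5.10) is a factor `2`.  Why it might fail: a determinantal stable family whose Agler
ranks grow like Knese's dimension count.  Size: L (open). -/
def Stmt.stub_priceOfUnitarity : Prop :=
  ∃ d : ℕ, ∀ (N R : ℕ) {σ : Type} [Fintype σ] (p : MvPolynomial σ ℂ) (κ : Fin R → σ),
    Fintype.card σ ≤ N →
    (∀ z : σ → ℂ, (∀ j, ‖z j‖ ≤ 2) → MvPolynomial.eval z p ≠ 0) →
    HasContractiveDetReprWith p κ →
    ∃ R' ≤ 2 ^ ((Nat.log 2 (R + N) + d) ^ d), ∃ (κ' : Fin R' → σ)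
      (U : Matrix (Fin 1 ⊕ Fin R') (Fin 1 ⊕ Fin R') ℂ),
      U ∈ Matrix.unitaryGroup (Fin 1 ⊕ Fin R') ℂ ∧
      IsRealizedBy κ' U (conjReverse (blockOrder κ) p) p

/-- STUB 1a — REALIZATIONS PUSH FORWARD ALONG COLOURINGS (provable now; RESHAPE 4).  A realization
of `z^𝟙 p̄₀(1/z)/p₀`, `p₀ = det(I − K Z_id)` (one fresh variable per row), with block structure `κ'`
gives, for every colouring `κ : Fin R → σ`, a realization of `z^{blockOrder κ} p̄(1/z)/p`,
`p = det(I − K Z_κ) = rename κ p₀`, with block structure `κ ∘ κ'` and the same `U`: apply the ring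
map `rename κ` to the realization identity (`gkvwDet_eq_rename`, `conjReverse_blockOrder_gkvwDet`,
`RingHom.map_det`, `RingHom.map_adjugate`).  Size: M. -/
def Stmt.stub_realizationRename : Prop :=
  ∀ (R R' : ℕ) {σ : Type} (κ : Fin R → σ) (K : Matrix (Fin R) (Fin R) ℂ) (κ' : Fin R' → Fin R)
    (U : Matrix (Fin 1 ⊕ Fin R') (Fin 1 ⊕ Fin R') ℂ),
    IsRealizedBy κ' U (conjReverse (blockOrder (id : Fin R → Fin R)) (gkvwDet (id : Fin R → Fin R) K))
        (gkvwDet (id : Fin R → Fin R) K) →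
    IsRealizedBy (κ ∘ κ') U (conjReverse (blockOrder κ) (gkvwDet κ K)) (gkvwDet κ K)

/-- STUB 1b — PRICE OF UNITARITY FOR DISTINCT VARIABLES, MARGIN-FREE (open; RESHAPE 4).  There
is `d` such that for every `R × R` contraction `K`, the rational inner function
`det(Z − K^*)/det(I − K Z)` in the `R` distinct variables `Z = diag(z₁, …, z_R)`
(Schur–Agler by GKVW Thm 5.2, finitely realizable by Knese 2011) has a UNITARY transfer-function
realization of order `R' ≤ 2^((log₂ R + d)^d)`.  Known: order `≤ R · 2^{R−1}` (Knese's degree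
bounds, Thm 2.2 of arXiv:1010.0715 / [gK10]); numerically the minimum is `R(R−1)` for `R ≤ 5`
(generic and rank-one `K`).  Why it might fail: a contraction family whose determinantal inner
functions need Agler decompositions of exponential rank — none is known or suggested by the data.
Size: L (open). -/
def Stmt.stub_priceDistinct : Prop :=
  ∃ d : ℕ, ∀ (R : ℕ) (K : Matrix (Fin R) (Fin R) ℂ), IsContraction K →
    ∃ R' ≤ 2 ^ ((Nat.log 2 R + d) ^ d), ∃ (κ' : Fin R' → Fin R)
      (U : Matrix (Fin 1 ⊕ Fin R') (Fin 1 ⊕ Fin R') ℂ),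
      U ∈ Matrix.unitaryGroup (Fin 1 ⊕ Fin R') ℂ ∧
      IsRealizedBy κ' U (conjReverse (blockOrder (id : Fin R → Fin R)) (gkvwDet (id : Fin R → Fin R) K))
        (gkvwDet (id : Fin R → Fin R) K)

/-- The old price stub from the two new ones (RESHAPE 4; sorry-free): realize the
distinct-variable pencil of the given `K`, push the realization forward along `κ`, and compare the
bounds (`log₂ R ≤ log₂ (R + N)`).  The margin hypothesis is not needed. -/
theorem priceOfUnitarity_of :
    Stmt.stub_realizationRename → Stmt.stub_priceDistinct → Stmt.stub_priceOfUnitarity := by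
  intro hRen hDist
  obtain ⟨d, hd⟩ := hDist
  refine ⟨d, fun N R σ _ p κ _hN _hz hrep => ?_⟩
  obtain ⟨K, hK, hp⟩ := hrep
  obtain ⟨R', hR', κ', U, hU, hreal⟩ := hd R K hK
  refine ⟨R', hR'.trans ?_, κ ∘ κ', U, hU, ?_⟩
  · apply Nat.pow_le_pow_right (by norm_num)
    apply Nat.pow_le_pow_left
    exact Nat.add_le_add_right (Nat.log_mono_right (Nat.le_add_right R N)) d
  · rw [hp]
    exact hRen R R' κ K κ' U hreal

/-- STUB 2a — REALIZATION HARDNESS, NON-SURJECTIVE BLOCK STRUCTURE (PROVED by the lead, Theorems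
file `ContractivityPriceContractiveHardnessNonSurjective.lean`).  If `κ : Fin R → [n]²` is not
surjective (some variable `e` is missed, so `blockOrder κ e = 0`), then for EVERY order `κ'` and every
unitary `U`, `U` does not realize `conjReverse (blockOrder κ) Q_n / Q_n`: the quotient is not even a
Schur function (at `z⋆ = 𝟙[e ↦ 0]` its modulus is `Q_n(𝟙)/Q_n(𝟙[e ↦ 0]) > 1`).  No size bound is
needed.  Size: M (done). -/
def Stmt.stub_realizationHardness_nonSurjective : Prop :=
  ∀ (n R : ℕ) (κ : Fin R → Fin n × Fin n), ¬ Function.Surjective κ →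
    ∀ (R' : ℕ) (κ' : Fin R' → Fin n × Fin n)
      (U : Matrix (Fin 1 ⊕ Fin R') (Fin 1 ⊕ Fin R') ℂ),
      U ∈ Matrix.unitaryGroup (Fin 1 ⊕ Fin R') ℂ →
      ¬ IsRealizedBy κ' U
          (conjReverse (blockOrder κ)
            (MvPolynomial.aeval (fun e : Fin n × Fin n =>
                MvPolynomial.C (if e.1 = e.2 then (1 : ℂ) else 0) +
                  MvPolynomial.C ((4 * (n : ℂ))⁻¹) * MvPolynomial.X e)
              (Literature.Computability.AlgebraicComplexity.perPoly (Fin n) ℂ)))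
          (MvPolynomial.aeval (fun e : Fin n × Fin n =>
              MvPolynomial.C (if e.1 = e.2 then (1 : ℂ) else 0) +
                MvPolynomial.C ((4 * (n : ℂ))⁻¹) * MvPolynomial.X e)
            (Literature.Computability.AlgebraicComplexity.perPoly (Fin n) ℂ))

/-- STUB 2b — SURJECTIVE REDUCTION (PROVED by the lead, Theorems file
`ContractivityPriceContractiveHardnessSurjectiveReduction.lean`; the argument of GKVW Thm 5.6 for
`Q_n`).  For `n ≥ 2` and SURJECTIVE `κ`, a colligation `U` (unitary or not) realizing
`conjReverse (blockOrder κ) Q_n / Q_n` with block structure `κ'` has `Q_n ∣ det(I − U₂₂ Z_{κ'})`.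
Size: M (done). -/
def Stmt.stub_surjectiveReduction : Prop :=
  ∀ (n R : ℕ) (κ : Fin R → Fin n × Fin n), 2 ≤ n → Function.Surjective κ →
    ∀ (R' : ℕ) (κ' : Fin R' → Fin n × Fin n)
      (U : Matrix (Fin 1 ⊕ Fin R') (Fin 1 ⊕ Fin R') ℂ),
      IsRealizedBy κ' U
          (conjReverse (blockOrder κ)
            (MvPolynomial.aeval (fun e : Fin n × Fin n =>
                MvPolynomial.C (if e.1 = e.2 then (1 : ℂ) else 0) +
                  MvPolynomial.C ((4 * (n : ℂ))⁻¹) * MvPolynomial.X e)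
              (Literature.Computability.AlgebraicComplexity.perPoly (Fin n) ℂ)))
          (MvPolynomial.aeval (fun e : Fin n × Fin n =>
                MvPolynomial.C (if e.1 = e.2 then (1 : ℂ) else 0) +
                  MvPolynomial.C ((4 * (n : ℂ))⁻¹) * MvPolynomial.X e)
              (Literature.Computability.AlgebraicComplexity.perPoly (Fin n) ℂ)) →
      (MvPolynomial.aeval (fun e : Fin n × Fin n =>
                MvPolynomial.C (if e.1 = e.2 then (1 : ℂ) else 0) +
                  MvPolynomial.C ((4 * (n : ℂ))⁻¹) * MvPolynomial.X e)
              (Literature.Computability.AlgebraicComplexity.perPoly (Fin n) ℂ)) ∣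
        gkvwDet κ' U.toBlocks₂₂

/-- STUB 2c — DEFECT-ONE CONTRACTIVE MULTIPLES OF THE STABILISED PERMANENT ARE HARD (open; the
hardness core "CMH₁", hardest stub).  For every `c'` there is `n ≥ 2` such that for every block
structure `κ' : Fin R' → [n]²` with `R' ≤ 2^((log₂ n + c')^c')` and every UNITARY `U` on
`ℂ ⊕ ℂ^{R'}`, the stabilised permanent `Q_n` does NOT divide the state-pencil determinant
`det(I − U₂₂ Z_{κ'})`: no quasi-polynomial contractive pencil whose matrix is the corner of a unitary
(a contraction of defect ≤ 1) computes a MULTIPLE of `Q_n`.  Why plausibly true: failure i.o. gives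
`dc(Q_n · q) ≤ R'` quasi-polynomial, hence (factor closure of quasi-polynomial determinantal /
ABP size, Kaltofen; Sinhababu–Thierauf) `dc(per_n)` quasi-polynomial — it is implied, morally, by
the extended Valiant hypothesis, like the crux.  Why it might fail: nothing known separates
defect-one pencils computing multiples from general affine pencils; `cdc(Q_2) = 4` already with
‖K‖ ≤ 1/4.  A priori incomparable with the crux (restricted matrices, multiples allowed).
Size: XL (open).  Since RESHAPE 3 this is no longer a registered stub: it is kept as the
reference statement implying the registered core (`stub_unitaryRealizationHardCore_of_CMH₁`). -/
def Stmt.stub_defectOneMultiplesHard : Prop :=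
  ∀ c' : ℕ, ∃ n : ℕ, 2 ≤ n ∧ ∀ R' ≤ 2 ^ ((Nat.log 2 n + c') ^ c'), ∀ (κ' : Fin R' → Fin n × Fin n)
      (U : Matrix (Fin 1 ⊕ Fin R') (Fin 1 ⊕ Fin R') ℂ),
      U ∈ Matrix.unitaryGroup (Fin 1 ⊕ Fin R') ℂ →
      ¬ ((MvPolynomial.aeval (fun e : Fin n × Fin n =>
                MvPolynomial.C (if e.1 = e.2 then (1 : ℂ) else 0) +
                  MvPolynomial.C ((4 * (n : ℂ))⁻¹) * MvPolynomial.X e)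
              (Literature.Computability.AlgebraicComplexity.perPoly (Fin n) ℂ)) ∣
          gkvwDet κ' U.toBlocks₂₂)

/-- STUB 2c′ — DIVISIBILITY FORCES EVERY VARIABLE TO BE READ (provable now; variable counting;
RESHAPE 3).  For `n ≥ 1`: if `Q_n` divides a pencil determinant `det(I − D Z_{κ'})` (ANY square
`D`, no norm), then the block structure `κ'` is surjective — `det(I − D Z_{κ'})` only involves
the variables in the range of `κ'` (`vars_gkvwDet_subset_image`), a divisor of a non-zero
polynomial over `ℂ` only involves variables of that polynomial (`vars_subset_vars_of_dvd`; the
pencil determinant has constant term `1`), and every `z_e` occurs in `Q_n` (`mem_vars_stabPer`).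
Consequently `R' ≥ n²`: the instances `c' ≤ 1` of CMH₁.  Size: S. -/
def Stmt.stub_dvdForcesSurjective : Prop :=
  ∀ n : ℕ, 1 ≤ n → ∀ (R' : ℕ) (κ' : Fin R' → Fin n × Fin n) (D : Matrix (Fin R') (Fin R') ℂ),
    (MvPolynomial.aeval (fun e : Fin n × Fin n =>
          MvPolynomial.C (if e.1 = e.2 then (1 : ℂ) else 0) +
            MvPolynomial.C ((4 * (n : ℂ))⁻¹) * MvPolynomial.X e)
        (Literature.Computability.AlgebraicComplexity.perPoly (Fin n) ℂ)) ∣ gkvwDet κ' D →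
    Function.Surjective κ'

/-- STUB 2c″ — THE HARDNESS CORE IN ITS WEAKEST FORM (open; hardest stub; RESHAPE 3).  For all
`c, c'` there is `n ≥ 2` such that the following data are contradictory: a contractive
realization `Q_n = det(I − K Z_κ)` with SURJECTIVE block structure `κ : Fin R → [n]²`,
`R ≤ 2^((log₂ n + c)^c)` (`HasContractiveDetReprWith`); a UNITARY colligation `U` on `ℂ ⊕ ℂ^{R'}`,
`R' ≤ 2^((log₂ n + c')^c')`, with surjective block structure `κ'`, realizing the rational inner
function `z^{blockOrder κ} Q̄_n(1/z) / Q_n` (`IsRealizedBy`); and the divisibility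
`Q_n ∣ det(I − U₂₂ Z_{κ'})`.  (The last two hypotheses are what the price stub, the surjective
reduction and variable counting deliver; the statement is implied by CMH₁, by the crux restricted to
surjective `κ`, and morally by the extended Valiant hypothesis + factor closure.)  What a proof may
use beyond the bare crux: `U₂₂` is a contraction of defect `≤ 1` (`toBlocks₂₂_defect_eq`), i.e. an
Agler decomposition `|Q_n q|² − |q · z^m Q̄_n(1/z)|² = Σ_i (1 − |z_{κ'(i)}|²)|G_i|²` of total rank
`R'`; face/parity consequence (lead c1): multiplicity `≥ 2` of every variable in `κ'` already at
`n = 2`, where the least `R'` is `8 = 2n²`.  Why it might fail: nothing known separates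
defect-one pencils from general affine pencils beyond polynomial factors.  Size: XL (open). -/
def Stmt.stub_unitaryRealizationHardCore : Prop :=
  ∀ c c' : ℕ, ∃ n : ℕ, 2 ≤ n ∧
    ∀ R ≤ 2 ^ ((Nat.log 2 n + c) ^ c), ∀ (κ : Fin R → Fin n × Fin n), Function.Surjective κ →
      HasContractiveDetReprWith
          (MvPolynomial.aeval (fun e : Fin n × Fin n =>
              MvPolynomial.C (if e.1 = e.2 then (1 : ℂ) else 0) +
                MvPolynomial.C ((4 * (n : ℂ))⁻¹) * MvPolynomial.X e)
            (Literature.Computability.AlgebraicComplexity.perPoly (Fin n) ℂ)) κ →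
      ∀ R' ≤ 2 ^ ((Nat.log 2 n + c') ^ c'), ∀ (κ' : Fin R' → Fin n × Fin n),
        Function.Surjective κ' →
        ∀ (U : Matrix (Fin 1 ⊕ Fin R') (Fin 1 ⊕ Fin R') ℂ),
          U ∈ Matrix.unitaryGroup (Fin 1 ⊕ Fin R') ℂ →
          IsRealizedBy κ' U
              (conjReverse (blockOrder κ)
                (MvPolynomial.aeval (fun e : Fin n × Fin n =>
                    MvPolynomial.C (if e.1 = e.2 then (1 : ℂ) else 0) +
                      MvPolynomial.C ((4 * (n : ℂ))⁻¹) * MvPolynomial.X e)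
                  (Literature.Computability.AlgebraicComplexity.perPoly (Fin n) ℂ)))
              (MvPolynomial.aeval (fun e : Fin n × Fin n =>
                  MvPolynomial.C (if e.1 = e.2 then (1 : ℂ) else 0) +
                    MvPolynomial.C ((4 * (n : ℂ))⁻¹) * MvPolynomial.X e)
                (Literature.Computability.AlgebraicComplexity.perPoly (Fin n) ℂ)) →
          ¬ ((MvPolynomial.aeval (fun e : Fin n × Fin n =>
                  MvPolynomial.C (if e.1 = e.2 then (1 : ℂ) else 0) +
                    MvPolynomial.C ((4 * (n : ℂ))⁻¹) * MvPolynomial.X e)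
                (Literature.Computability.AlgebraicComplexity.perPoly (Fin n) ℂ)) ∣
              gkvwDet κ' U.toBlocks₂₂)

/-- The reshape is monotone: CMH₁ implies the registered core (forget the extra hypotheses). -/
theorem stub_unitaryRealizationHardCore_of_CMH₁ :
    Stmt.stub_defectOneMultiplesHard → Stmt.stub_unitaryRealizationHardCore := by
  intro h c c'
  obtain ⟨n, hn2, hn⟩ := h c'
  exact ⟨n, hn2, fun _R _hR _κ _hκ _hcdr R' hR' κ' _hκ' U hU _hreal => hn R' hR' κ' U hU⟩

/-! ## Registered stubs (the ONLY sorries of this file) -/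

/-- Registered stub 1a = `Stmt.stub_realizationRename` (RESHAPE 4; realizations push forward along
colourings) — CLOSED: it is the landed theorem
`Summit.ValiantsHypothesis.ValiantsHypothesis.Theorems.stub_realizationRename`
(`Theorems/ContractivityPriceContractiveHardnessRealizationRename.lean`, p155269, wave 2 of lead c2). -/
theorem stub_realizationRename :
    ∀ (R R' : ℕ) {σ : Type} (κ : Fin R → σ) (K : Matrix (Fin R) (Fin R) ℂ) (κ' : Fin R' → Fin R)
      (U : Matrix (Fin 1 ⊕ Fin R') (Fin 1 ⊕ Fin R') ℂ),
      IsRealizedBy κ' U (conjReverse (blockOrder (id : Fin R → Fin R)) (gkvwDet (id : Fin R → Fin R) K))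
          (gkvwDet (id : Fin R → Fin R) K) →
      IsRealizedBy (κ ∘ κ') U (conjReverse (blockOrder κ) (gkvwDet κ K)) (gkvwDet κ K) :=
  fun R R' _ κ K κ' U h =>
    Summit.ValiantsHypothesis.ValiantsHypothesis.Theorems.stub_realizationRename R R' κ K κ' U h

/-- Registered stub 1b = `Stmt.stub_priceDistinct` (RESHAPE 4; the open core of the price of
unitarity: distinct variables, margin-free, quasi-polynomial — conjecturally `R(R−1)` — order). -/
theorem stub_priceDistinct :
    ∃ d : ℕ, ∀ (R : ℕ) (K : Matrix (Fin R) (Fin R) ℂ), IsContraction K →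
      ∃ R' ≤ 2 ^ ((Nat.log 2 R + d) ^ d), ∃ (κ' : Fin R' → Fin R)
        (U : Matrix (Fin 1 ⊕ Fin R') (Fin 1 ⊕ Fin R') ℂ),
        U ∈ Matrix.unitaryGroup (Fin 1 ⊕ Fin R') ℂ ∧
        IsRealizedBy κ' U (conjReverse (blockOrder (id : Fin R → Fin R)) (gkvwDet (id : Fin R → Fin R) K))
          (gkvwDet (id : Fin R → Fin R) K) := by
  sorry

/-- The old registered stub 1 = `Stmt.stub_priceOfUnitarity`, now DERIVED (RESHAPE 4) from stubs
1a and 1b by `priceOfUnitarity_of`. -/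
theorem stub_priceOfUnitarity :
    ∃ d : ℕ, ∀ (N R : ℕ) {σ : Type} [Fintype σ] (p : MvPolynomial σ ℂ) (κ : Fin R → σ),
      Fintype.card σ ≤ N →
      (∀ z : σ → ℂ, (∀ j, ‖z j‖ ≤ 2) → MvPolynomial.eval z p ≠ 0) →
      HasContractiveDetReprWith p κ →
      ∃ R' ≤ 2 ^ ((Nat.log 2 (R + N) + d) ^ d), ∃ (κ' : Fin R' → σ)
        (U : Matrix (Fin 1 ⊕ Fin R') (Fin 1 ⊕ Fin R') ℂ),
        U ∈ Matrix.unitaryGroup (Fin 1 ⊕ Fin R') ℂ ∧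
        IsRealizedBy κ' U (conjReverse (blockOrder κ) p) p :=
  priceOfUnitarity_of stub_realizationRename stub_priceDistinct

/-- Registered stub 2a = `Stmt.stub_realizationHardness_nonSurjective` (non-surjective block
structure: no unitary realization of any order) — CLOSED: it is the landed theorem
`Summit.ValiantsHypothesis.ValiantsHypothesis.Theorems.stub_realizationHardness_nonSurjective`
(`Theorems/ContractivityPriceContractiveHardnessNonSurjective.lean`, p147230). -/
theorem stub_realizationHardness_nonSurjective :
    ∀ (n R : ℕ) (κ : Fin R → Fin n × Fin n), ¬ Function.Surjective κ →
      ∀ (R' : ℕ) (κ' : Fin R' → Fin n × Fin n)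
        (U : Matrix (Fin 1 ⊕ Fin R') (Fin 1 ⊕ Fin R') ℂ),
        U ∈ Matrix.unitaryGroup (Fin 1 ⊕ Fin R') ℂ →
        ¬ IsRealizedBy κ' U
            (conjReverse (blockOrder κ)
              (MvPolynomial.aeval (fun e : Fin n × Fin n =>
                  MvPolynomial.C (if e.1 = e.2 then (1 : ℂ) else 0) +
                    MvPolynomial.C ((4 * (n : ℂ))⁻¹) * MvPolynomial.X e)
                (Literature.Computability.AlgebraicComplexity.perPoly (Fin n) ℂ)))
            (MvPolynomial.aeval (fun e : Fin n × Fin n =>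
                MvPolynomial.C (if e.1 = e.2 then (1 : ℂ) else 0) +
                  MvPolynomial.C ((4 * (n : ℂ))⁻¹) * MvPolynomial.X e)
              (Literature.Computability.AlgebraicComplexity.perPoly (Fin n) ℂ)) :=
  Summit.ValiantsHypothesis.ValiantsHypothesis.Theorems.stub_realizationHardness_nonSurjective

/-- Registered stub 2b = `Stmt.stub_surjectiveReduction` (surjective block structure: a realization
makes `Q_n` divide the state-pencil determinant) — CLOSED: it is the landed theorem
`Summit.ValiantsHypothesis.ValiantsHypothesis.Theorems.stub_surjectiveReduction`
(`Theorems/ContractivityPriceContractiveHardnessSurjectiveReduction.lean`, p148766). -/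
theorem stub_surjectiveReduction :
    ∀ (n R : ℕ) (κ : Fin R → Fin n × Fin n), 2 ≤ n → Function.Surjective κ →
      ∀ (R' : ℕ) (κ' : Fin R' → Fin n × Fin n)
        (U : Matrix (Fin 1 ⊕ Fin R') (Fin 1 ⊕ Fin R') ℂ),
        IsRealizedBy κ' U
            (conjReverse (blockOrder κ)
              (MvPolynomial.aeval (fun e : Fin n × Fin n =>
                MvPolynomial.C (if e.1 = e.2 then (1 : ℂ) else 0) +
                  MvPolynomial.C ((4 * (n : ℂ))⁻¹) * MvPolynomial.X e)
              (Literature.Computability.AlgebraicComplexity.perPoly (Fin n) ℂ)))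
            (MvPolynomial.aeval (fun e : Fin n × Fin n =>
                MvPolynomial.C (if e.1 = e.2 then (1 : ℂ) else 0) +
                  MvPolynomial.C ((4 * (n : ℂ))⁻¹) * MvPolynomial.X e)
              (Literature.Computability.AlgebraicComplexity.perPoly (Fin n) ℂ)) →
        (MvPolynomial.aeval (fun e : Fin n × Fin n =>
                MvPolynomial.C (if e.1 = e.2 then (1 : ℂ) else 0) +
                  MvPolynomial.C ((4 * (n : ℂ))⁻¹) * MvPolynomial.X e)
              (Literature.Computability.AlgebraicComplexity.perPoly (Fin n) ℂ)) ∣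
          gkvwDet κ' U.toBlocks₂₂ :=
  Summit.ValiantsHypothesis.ValiantsHypothesis.Theorems.stub_surjectiveReduction

/-- Registered stub 2c′ = `Stmt.stub_dvdForcesSurjective` (RESHAPE 3; variable counting: a pencil
determinant divisible by `Q_n` reads every variable) — CLOSED: it is the landed theorem
`Summit.ValiantsHypothesis.ValiantsHypothesis.Theorems.stub_dvdForcesSurjective`
(`Theorems/ContractivityPriceContractiveHardnessDvdForcesSurjective.lean`, p152734, wave 1 of lead c2). -/
theorem stub_dvdForcesSurjective :
    ∀ n : ℕ, 1 ≤ n → ∀ (R' : ℕ) (κ' : Fin R' → Fin n × Fin n) (D : Matrix (Fin R') (Fin R') ℂ),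
      (MvPolynomial.aeval (fun e : Fin n × Fin n =>
            MvPolynomial.C (if e.1 = e.2 then (1 : ℂ) else 0) +
              MvPolynomial.C ((4 * (n : ℂ))⁻¹) * MvPolynomial.X e)
          (Literature.Computability.AlgebraicComplexity.perPoly (Fin n) ℂ)) ∣ gkvwDet κ' D →
      Function.Surjective κ' :=
  Summit.ValiantsHypothesis.ValiantsHypothesis.Theorems.stub_dvdForcesSurjective

/-- Registered stub 2c″ = `Stmt.stub_unitaryRealizationHardCore` (RESHAPE 3; the open core in its
weakest form: contractive realization + quasi-polynomial unitary realization of the reflection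
quotient + divisibility are contradictory for some `n`). -/
theorem stub_unitaryRealizationHardCore :
    ∀ c c' : ℕ, ∃ n : ℕ, 2 ≤ n ∧
      ∀ R ≤ 2 ^ ((Nat.log 2 n + c) ^ c), ∀ (κ : Fin R → Fin n × Fin n), Function.Surjective κ →
        HasContractiveDetReprWith
            (MvPolynomial.aeval (fun e : Fin n × Fin n =>
                MvPolynomial.C (if e.1 = e.2 then (1 : ℂ) else 0) +
                  MvPolynomial.C ((4 * (n : ℂ))⁻¹) * MvPolynomial.X e)
              (Literature.Computability.AlgebraicComplexity.perPoly (Fin n) ℂ)) κ →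
        ∀ R' ≤ 2 ^ ((Nat.log 2 n + c') ^ c'), ∀ (κ' : Fin R' → Fin n × Fin n),
          Function.Surjective κ' →
          ∀ (U : Matrix (Fin 1 ⊕ Fin R') (Fin 1 ⊕ Fin R') ℂ),
            U ∈ Matrix.unitaryGroup (Fin 1 ⊕ Fin R') ℂ →
            IsRealizedBy κ' U
                (conjReverse (blockOrder κ)
                  (MvPolynomial.aeval (fun e : Fin n × Fin n =>
                      MvPolynomial.C (if e.1 = e.2 then (1 : ℂ) else 0) +
                        MvPolynomial.C ((4 * (n : ℂ))⁻¹) * MvPolynomial.X e)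
                    (Literature.Computability.AlgebraicComplexity.perPoly (Fin n) ℂ)))
                (MvPolynomial.aeval (fun e : Fin n × Fin n =>
                    MvPolynomial.C (if e.1 = e.2 then (1 : ℂ) else 0) +
                      MvPolynomial.C ((4 * (n : ℂ))⁻¹) * MvPolynomial.X e)
                  (Literature.Computability.AlgebraicComplexity.perPoly (Fin n) ℂ)) →
            ¬ ((MvPolynomial.aeval (fun e : Fin n × Fin n =>
                    MvPolynomial.C (if e.1 = e.2 then (1 : ℂ) else 0) +
                      MvPolynomial.C ((4 * (n : ℂ))⁻¹) * MvPolynomial.X e)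
                  (Literature.Computability.AlgebraicComplexity.perPoly (Fin n) ℂ)) ∣
                gkvwDet κ' U.toBlocks₂₂) := by
  sorry

/-! ## The composition (kernel-checked, sorry-free) -/

/-- **The crux from the five stubs.**  Given `c`: `d` from the price stub, `c'` from the proved support
`qpComposition_proof c d`, `n ≥ 2` from the core at `(c, c')`.  A contractive realization
`Q_n = C a · det(1 + diag(X ∘ κ) · K)` of size `R ≤ 2^((log₂ n + c)^c)` is a
`HasContractiveDetReprWith Q_n κ₀` (`Q_n(0) = 1` and the tree's bridge
`hasContractiveDetRepr_iff_exists_C_mul`); `Q_n` has no zero on the radius-`2` polydisc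
(`stabilisedPerZeroFree_proof`, proved support of the route); so the price stub with `N = n²` yields a
unitary realization of order `R' ≤ 2^((log₂(R + n²) + d)^d) ≤ 2^((log₂ n + c')^c')`; if `κ₀` misses
a variable the non-surjective stub forbids it outright; otherwise the surjective reduction makes `Q_n`
divide the state-pencil determinant, so `κ'` is surjective (variable counting), and the core forbids
the whole configuration. -/
theorem ContractiveHardness_of :
    Stmt.stub_priceOfUnitarity → Stmt.stub_realizationHardness_nonSurjective →
      Stmt.stub_surjectiveReduction → Stmt.stub_dvdForcesSurjective →
      Stmt.stub_unitaryRealizationHardCore →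
      Summit.ValiantsHypothesis.ValiantsHypothesis.Theses.ContractivityPrice.ContractiveHardness := by
  intro hP hNS hSR hDS hCore
  unfold Stmt.stub_priceOfUnitarity at hP
  unfold Stmt.stub_realizationHardness_nonSurjective at hNS
  unfold Stmt.stub_surjectiveReduction at hSR
  unfold Stmt.stub_dvdForcesSurjective at hDS
  unfold Stmt.stub_unitaryRealizationHardCore at hCore
  show ∀ c : ℕ, ∃ n : ℕ, ∀ R ≤ 2 ^ ((Nat.log 2 n + c) ^ c), ∀ (a : ℂ) (K : Matrix (Fin R) (Fin R) ℂ)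
      (κ : Fin R → Fin n × Fin n), ‖Matrix.toEuclideanCLM (𝕜 := ℂ) K‖ ≤ 1 →
      stabPer n ≠ MvPolynomial.C a * (1 + Matrix.diagonal (fun i => MvPolynomial.X (κ i)) *
        K.map (fun a : ℂ => (MvPolynomial.C a : MvPolynomial (Fin n × Fin n) ℂ))).det
  intro c
  obtain ⟨d, hd⟩ := hP
  obtain ⟨c', hc'⟩ :=
    Summit.ValiantsHypothesis.ValiantsHypothesis.Theorems.qpComposition_proof c d
  obtain ⟨n, hn2, hn⟩ := hCore c c'
  refine ⟨n, fun R hR a K κ hK hQ => ?_⟩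
  -- the realization is a contractive determinantal representation in the tree's sense
  have hcdr : HasContractiveDetRepr (stabPer n) R :=
    (hasContractiveDetRepr_iff_exists_C_mul (eval_zero_stabPer n) R).mpr ⟨a, K, κ, hK, hQ⟩
  obtain ⟨κ₀, hκ₀⟩ := hcdr
  -- the radius-2 margin of `Q_n` (proved support item `StabilisedPerZeroFree`)
  have hzf : ∀ z : Fin n × Fin n → ℂ, (∀ j, ‖z j‖ ≤ 2) → MvPolynomial.eval z (stabPer n) ≠ 0 :=
    fun z hz => Summit.ValiantsHypothesis.ValiantsHypothesis.Theorems.stabilisedPerZeroFree_proof n z hz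
  -- price of unitarity with `N = n²` variables
  obtain ⟨R', hR', κ', U, hU, hreal⟩ := hd (n ^ 2) R (stabPer n) κ₀ (by simp [sq]) hzf hκ₀
  have hR'' : R' ≤ 2 ^ ((Nat.log 2 n + c') ^ c') := hR'.trans (hc' n R (n ^ 2) hR le_rfl)
  -- split on surjectivity of the block structure
  by_cases hsurj : Function.Surjective κ₀
  · -- surjective: `Q_n` divides the state-pencil determinant, `κ'` reads every variable; core
    have hdvd : stabPer n ∣ gkvwDet κ' U.toBlocks₂₂ := hSR n R κ₀ hn2 hsurj R' κ' U hreal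
    have hsurj' : Function.Surjective κ' := hDS n (by omega) R' κ' U.toBlocks₂₂ hdvd
    exact hn R hR κ₀ hsurj hκ₀ R' hR'' κ' hsurj' U hU hreal hdvd
  · -- a missed variable: no realization of any order
    exact hNS n R κ₀ hsurj R' κ' U hU hreal

/-- THE SKELETON: the crux, modulo exactly the registered stubs (compiler-checks that the `Stmt`
copies and the stub statements agree; since RESHAPE 4 the price enters through
`stub_priceOfUnitarity = priceOfUnitarity_of stub_realizationRename stub_priceDistinct`). -/
theorem ContractiveHardness_proof :
    Summit.ValiantsHypothesis.ValiantsHypothesis.Theses.ContractivityPrice.ContractiveHardness :=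
  ContractiveHardness_of stub_priceOfUnitarity stub_realizationHardness_nonSurjective
    stub_surjectiveReduction stub_dvdForcesSurjective stub_unitaryRealizationHardCore

end

end Summit.ValiantsHypothesis.ValiantsHypothesis.Cruxes.ContractiveHardness.Birth
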